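import Summits.QuantumFields.BalabanUV.T4Continuum.Support.ShellMeasureLandauEndRayStokesAssembled
import Summits.QuantumFields.BalabanUV.T4Continuum.Support.ShellMeasureLandauWilsonSquaresSchwarz

/-!
# `T4Continuum.ShellMeasureLandauEndRayStokesAssembledSchwarz` — row S85 f2, file 3: THE S80 TWIN — END-II-final ASSEMBLED
# WITH THE WILSON SLOT FIRED AT TWO RADII (owner audit γ6 «COUPLING» carried to the most-assembled declaration of record)
(cell `pub-balaban`, sub-cell `t4`, spine estimate NE7c (node U5b); NE7c ROUND-2 crew, unit
`b2b-balaban-t4-ne7c-formalise-leaf-09` gen 12; owner table `t4/b2b-balaban-t4-ne7c-p1/LEAVES-NE7c-P1.md` row **S85 f2**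
(owner ruling R-ne7cp1-g32-2 (b) «S80's Wilson slot re-fired through S85 `hE_of_wilsonPlaquettes_schwarz` … then a 1-call S80
twin or an `H̄`-instantiation note if S80's `hsumw` already hosts it — say which»; CLAIM l.17994); ADDITIVE — imports leaf-04-g6's
S80 `ShellMeasureLandauEndRayStokesAssembled` (p227677: `wilsonProfile_nonneg`; hence S76 f2 `ShellMeasureLandauEndFinal`, S71 f2
`ShellMeasureRayTermsPinnedLandau`, S78 `ShellMeasureRayLogIntegral`) and this row's file 1 `ShellMeasureLandauWilsonSquaresSchwarz`
(`hE_landau_wilsonSquares_pinned_schwarz`) ONLY; every supplier consumed BY NAME; [folklore]; 0 `def`, 0 `def … : Prop`,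
0 sorry, 0 citation tags)

HONEST FRAMING.  Finite four-torus programme, rung (B)+1 only — NOT infinite volume, NOT a mass gap, NOT the Clay
problem, NOT summit progress; (B), `BetaPertHyp`, (B^μ) not consumed.  NE7c (`T4IndicatorShell.ShellWeightBound`) is
NOT PRINTED and NOT PROVED; «NE7c ⇐ the named binders» (+ F-ne7cp1-g30-1 decay halves, + F-ne7cp1-g31-1 curl read-out);
(M1) realized ≠ NE7c (c3).  Nothing printed is asserted: the equation numbers in binder comments LOCATE displayed SHAPES
((P2), (P4), (118)∕(121), (103), (75), (44), (46), (54); B11 (19)∕(25)∕(37); B12 (2.18)–(2.22); B14 (2.17)), not citations.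
HONEST DEPENDENCY (cell): continuum YM on T⁴ ⇐ BetaPertH ∧ nine spine estimates (0/9 proved); BetaPertH ⇐ (D1) ∧ (D4) ∧
CAP+tail; G-an2-4 gates asym, D1 and NE2/3/4.

WHY A TWIN AND NOT AN `H̄`-INSTANTIATION (the ruling's question, answered).  S80 `…_assembled` hard-wires S74 f2 §3
`hE_landau_wilsonSquares_pinned` at ONE radius: its slot constant carries `3H̄∕(r_Φ,w∕S − 1)` and its budget binder `hsumw` has
the FIRST-ORDER shape `Σ_p |β|(d_p + H_p)H_p ≤ H̄`; no choice of `H̄` turns that into the second-order constant (owner §1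
`oneRadius_BW_unbounded` vs `twoRadii_budget_le`).  S76 f2 `…_final` keeps the Wilson slot OPEN (`hEW`∕`hBW`∕`hWlb`), so the
second-order Wilson constant enters by ONE CALL of S76 f2 with `hEW := hE_landau_wilsonSquares_pinned_schwarz` — this file;
everything else (the non-Wilson slot S71 f2 ⊕ S78, `hWlb`, (SM) by S73 inside S76 f2) EXACTLY as S80, BY NAME.
THE THREE TUPLES (R-ne7cp1-g31-2, displayed, not reconciled here): (T1) the LOCALIZED (classifier) scheme tuple (S76); (T2) the
GLOBAL scheme tuple read through displayed pinned readings `π𝒴, …` (S74 f2 ∕ file 1 §3); (T3) the global tuple's PINNED INSTANCE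
`𝒴 := WSup (pinW δ′ ϖ) 1 𝔄` (S71 f2) — as in S80.
WHAT REMAINS A BINDER (c3): scheme∕read-out∕real-structure data of the three tuples, the pinned chain readings, the located
budgets `H̄` (SECOND ORDER now; file 2 `ShellMeasureLandauWilsonSquaresLocatedSchwarz.hsum_of_located_schwarz` locates it), `LK`
(S71 §3), the ω-uniform ray constant `B_d` with `hint`∕`hpos` (S78), the lower bounds, co-test∕window data, numbers, [dict].  No
estimate of Bałaban's is discharged; NOTHING in the countdown moves; NE7c NOT PROVED; spine PROVED 0∕9.
-/

noncomputable section

open Set Metric NormedSpace MeasureTheory Function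

namespace Summit.QuantumFields.BalabanUV.T4Continuum.ShellMeasureLandauEndRayStokesAssembledSchwarz

open scoped ENNReal
open Literature.MathematicalPhysics.QuantumFieldTheory.Balaban1983to89
open B11Prop6Scheme (Prop4Hyp)
open GaugeField (GaugeInvariant)
open T4ShellMeasure (SlotAntiConcentration)
open T4CubePoincare (cube)
open T4CubeChartGnomonic (SU2)
open T4CubeChartExp (expFibreChart)
open T4TreeGaugeFixing (NoClosedLoop fixTo)
open T4ShellMeasurePlaquette (expTail₂)
open ShellMeasureLevelAssembly (classifier)
open ShellMeasureMultiGridNorms (WSup)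
open ShellMeasurePinnedNorm (pinW)
open ShellMeasureLandauHolonomy (solAt landauExp)
open ShellMeasureLandauHolonomyChart (holOf cplx)
open ShellMeasureLandauHolonomySkew (readOutReal)
open ShellMeasureRayTermsPinnedLandau (hE_landau_chartRay_pinned)
open ShellMeasureRayLogIntegral (rayBound_of_logIntegral rayBound_add)
open ShellMeasureLandauEndFinal (slotAC_realized_su2_landauChart_final)
open ShellMeasureLandauEndRayStokesAssembled (wilsonProfile_nonneg)
open ShellMeasureLandauWilsonSquaresSchwarz (hE_landau_wilsonSquares_pinned_schwarz)

/-! ## END-II-final ASSEMBLED, the Wilson slot at two radii -/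

section Assembled

open scoped Matrix.Norms.L2Operator

variable {P : Params} {j : ℕ} [DecidableEq (PBond P j)]
variable {n : Type*} [Fintype n] [DecidableEq n] [Nonempty n]
variable {𝒴 𝒴' 𝒳 𝒵 ℬ : Type*} [NormedAddCommGroup 𝒴] [NormedSpace ℂ 𝒴] [CompleteSpace 𝒴]
  [NormedAddCommGroup 𝒴'] [NormedSpace ℂ 𝒴'] [NormedAddCommGroup 𝒳] [NormedSpace ℂ 𝒳] [CompleteSpace 𝒳]
  [NormedAddCommGroup 𝒵] [NormedSpace ℂ 𝒵] [NormedAddCommGroup ℬ] [NormedSpace ℂ ℬ]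

/-- **END-II-FINAL, ASSEMBLED — THE WILSON SLOT AT TWO RADII** (row S85 f2; the twin of S80
`ShellMeasureLandauEndRayStokesAssembled.slotAC_realized_su2_landauChart_assembled`).  S76 f2
`ShellMeasureLandauEndFinal.slotAC_realized_su2_landauChart_final` with BOTH 𝓔-slots DISCHARGED by the suppliers of record,
per exterior section `V` — the Wilson slot NOW by `ShellMeasureLandauWilsonSquaresSchwarz.hE_landau_wilsonSquares_pinned_schwarz`
over (T2) (S74 f2 §3 through the owner's S85 two-radii junction: constant `3H̄`, budget SECOND ORDER in the window), its
nonnegativity `hWlb` by S80 `wilsonProfile_nonneg` BY NAME, the non-Wilson slot by S71 f2 `hE_landau_chartRay_pinned` over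
(T3) ⊕ S78 `rayBound_of_logIntegral` through `rayBound_add` EXACTLY as S80.  Binders = S80's VERBATIM except: the Wilson
tuple's located number `hSrw : S < r_Φ,w` is REPLACED by the stronger `h2Sw : 2S ≤ r_Φ,w` (S85's inner radius `2 ≤ r_Φ,w∕S`)
and the Wilson budget `hsumw` has S85's second-order shape `Σ_p |β|(d_p + 2H_p∕(r_Φ,w∕S))(2H_p∕(r_Φ,w∕S)) ≤ H̄`,
`H_p = κ_c p·z_pin + expTail₂(m_w κ_w p z_pin)`.  CONCLUSION: (M1) per slot at the classifier threshold `εθ·η²` with the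
slot constant **`2(m₀ + (3H̄ + (3·LK·2z̄_e∕(r_Φ,e∕S − 1) + B_d)))∕(1 − δ)`** — NO `1∕(r_Φ,w∕S − 1)` on the Wilson side (owner
audit γ6, N-ne7cp1-g32-1: second order in the window, the coupling cancels; NOT a K-uniformity failure).  Every hypothesis
is a scheme∕read-out∕real-structure datum of one of the three displayed tuples, a located budget (`H̄`, `LK`, `B_d`), a
lower bound, a co-test∕window datum or a number; CONDITIONAL on all of them; nothing PRINTED is asserted; NOT Bałaban's
minimiser; (M1) realized ≠ NE7c. [folklore] -/
theorem slotAC_realized_su2_landauChart_assembled_schwarz {T : Finset (PBond P j)} (hT : NoClosedLoop T)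
    (U₀ : GaugeField P j SU2) (Λ : Finset (PBond P j)) {m₀ : ℕ} (e : ↥Λ × Fin 3 ≃ Fin m₀)
    {S : ℝ} (hS : 0 < S) (hSπ : 3 * S ^ 2 < Real.pi ^ 2) (c : GaugeField P j SU2 → GaugeField P j SU2)
    {F : GaugeField P j SU2 → ℝ≥0∞} (hF : Measurable F) (hFi : GaugeInvariant F)
    (hFsupp : ∀ V y, F (fixTo T U₀ (updateFinset V Λ y)) ≠ 0 →
      ∀ b (hb : b ∈ Λ), dist1 ((c V b)⁻¹ * y ⟨b, hb⟩) ≤ 2 * Real.sin (S / 2))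
    {u : GaugeField P j SU2 → ℝ} (hu : Measurable u) (hui : GaugeInvariant u)
    {ι : Type*} {Pu : Finset ι} (hPu : Pu.Nonempty)
    (W : GaugeField P j SU2 → Set (Fin m₀ → ℝ)) (Jco : GaugeField P j SU2 → (Fin m₀ → ℝ) → ℝ≥0∞)
    {δ ρ β : ℝ}
    (𝒢 : GaugeField P j SU2 → (𝒵 →L[ℂ] 𝒴)) (W𝒱 : GaugeField P j SU2 → 𝒴 → 𝒵) {B₀ C₄ a₃ ε₄ : ℝ}
    (h𝒢 : ∀ V f, ‖𝒢 V f‖ ≤ B₀ * ‖f‖) (hW : ∀ V, Prop4Hyp (W𝒱 V) C₄ a₃) (hB₀ : 0 < B₀) (hC₄ : 0 ≤ C₄)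
    (hε₄ : 0 ≤ ε₄)
    {dL C₁ B₃ ε₁ : ℝ} (hdL : 0 ≤ dL) (hC₁ : 0 ≤ C₁) (hε₁ : 0 ≤ ε₁) (hB₃ : dL ≤ B₃)
    (h1 : 2 * B₀ * C₁ * B₃ * ε₁ ≤ ε₄) (h2 : 4 * ε₄ ≤ a₃) (h3 : 16 * B₀ * C₄ * ε₄ ≤ 1)
    (H₁ : GaugeField P j SU2 → (ℬ →L[ℂ] 𝒴)) (hH₁ : ∀ V B, ‖H₁ V B‖ ≤ B₀ * ‖B‖)
    (Φ : GaugeField P j SU2 → (Fin m₀ → ℂ) → ℬ) {rΦ : ℝ} (hΦd : ∀ V, DifferentiableOn ℂ (Φ V) (ball 0 rΦ))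
    (hΦ0 : ∀ V, Φ V 0 = 0) (hΦ : ∀ V, ∀ z ∈ ball (0 : Fin m₀ → ℂ) rΦ, ‖Φ V z‖ < 2 * dL * C₁ * ε₁) (hSr : S < rΦ)
    (Cf : GaugeField P j SU2 → 𝒴' → 𝒳) {C₂ RC : ℝ} (hC₂ : 0 ≤ C₂)
    (hCq : ∀ V, ∀ Z : 𝒴', ‖Z‖ < RC → ‖Cf V Z‖ ≤ C₂ * ‖Z‖ ^ 2) (hCd : ∀ V, DifferentiableOn ℂ (Cf V) (ball 0 RC))
    (ιs : GaugeField P j SU2 → (𝒴 →L[ℂ] 𝒴')) (hι : ∀ V Y, ‖ιs V Y‖ ≤ ‖Y‖)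
    (Hop : GaugeField P j SU2 → (𝒳 →L[ℂ] 𝒴)) (hH : ∀ V X, ‖Hop V X‖ ≤ B₀ * ‖X‖)
    {ε₃ : ℝ} (h18 : 18 * C₂ * B₀ * ε₃ ≤ 1) (hcoup : ε₄ + B₀ * (2 * dL * C₁ * ε₁) ≤ ε₃) (h3R : 3 * ε₃ ≤ RC)
    (ℓs : ι → List (𝒴 →L[ℂ] Matrix n n ℂ)) {κr : ℝ} (hκ : 0 ≤ κr)
    (hℓ : ∀ p ∈ Pu, ∀ ℓ ∈ ℓs p, ∀ Y, ‖ℓ Y‖ ≤ κr * ‖Y‖) {m : ℕ} (hlen : ∀ p ∈ Pu, (ℓs p).length ≤ m)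
    {κc : ℝ} (hκc : 0 ≤ κc) (hcurl : ∀ p ∈ Pu, ∀ Y, ‖((ℓs p).map fun ℓ => ℓ Y).sum‖ ≤ κc * ‖Y‖)
    -- ══ (T2) THE WILSON SLOT'S SUPPLIER DATA (file 1 §3 `hE_landau_wilsonSquares_pinned_schwarz`, per exterior section `V`,
    -- V-uniform constants): the GLOBAL scheme tuple (P2)∕(P4)∕(118)∕(121)∕(103)∕(75)∕(44)∕scaling∕(46)∕(54), flat ══
    {𝒴w 𝒴w' 𝒳w 𝒵w ℬw P𝒴 P𝒴' P𝒳 Pℬ : Type*} [NormedAddCommGroup 𝒴w] [NormedSpace ℂ 𝒴w] [CompleteSpace 𝒴w]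
    [NormedAddCommGroup 𝒴w'] [NormedSpace ℂ 𝒴w'] [NormedAddCommGroup 𝒳w] [NormedSpace ℂ 𝒳w] [CompleteSpace 𝒳w]
    [NormedAddCommGroup 𝒵w] [NormedSpace ℂ 𝒵w] [NormedAddCommGroup ℬw] [NormedSpace ℂ ℬw]
    [NormedAddCommGroup P𝒴] [NormedSpace ℂ P𝒴] [NormedAddCommGroup P𝒴'] [NormedSpace ℂ P𝒴']
    [NormedAddCommGroup P𝒳] [NormedSpace ℂ P𝒳] [NormedAddCommGroup Pℬ] [NormedSpace ℂ Pℬ]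
    (𝒢w : GaugeField P j SU2 → (𝒵w →L[ℂ] 𝒴w)) (W𝒱w : GaugeField P j SU2 → 𝒴w → 𝒵w) {B₀w C₄w a₃w bw ε₄w : ℝ}
    (h𝒢w : ∀ V f, ‖𝒢w V f‖ ≤ B₀w * ‖f‖) (hWw : ∀ V, Prop4Hyp (W𝒱w V) C₄w a₃w) (hB₀w : 0 < B₀w) (hC₄w : 0 ≤ C₄w)
    (hε₄w : 0 ≤ ε₄w) (hdomw : 2 * (ε₄w + B₀w * bw) ≤ a₃w) (hselfw : B₀w * C₄w * (ε₄w + B₀w * bw) ^ 2 ≤ ε₄w)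
    (hcontrw : 4 * B₀w * C₄w * (ε₄w + B₀w * bw) < 1)
    (H₁w : GaugeField P j SU2 → (ℬw →L[ℂ] 𝒴w)) (hH₁w : ∀ V B, ‖H₁w V B‖ ≤ B₀w * ‖B‖)
    (Φw : GaugeField P j SU2 → (Fin m₀ → ℂ) → ℬw) {rΦw : ℝ} (hΦdw : ∀ V, DifferentiableOn ℂ (Φw V) (ball 0 rΦw))
    (hΦ0w : ∀ V, Φw V 0 = 0) (hΦbw : ∀ V, ∀ z ∈ ball (0 : Fin m₀ → ℂ) rΦw, ‖Φw V z‖ < bw) (h2Sw : 2 * S ≤ rΦw)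
    (Cw : GaugeField P j SU2 → 𝒴w' → 𝒳w) {C₂w RCw : ℝ} (hC₂w : 0 ≤ C₂w)
    (hCqw : ∀ V, ∀ Z : 𝒴w', ‖Z‖ < RCw → ‖Cw V Z‖ ≤ C₂w * ‖Z‖ ^ 2) (hCdw : ∀ V, DifferentiableOn ℂ (Cw V) (ball 0 RCw))
    (ιw : GaugeField P j SU2 → (𝒴w →L[ℂ] 𝒴w')) (hιw : ∀ V Y, ‖ιw V Y‖ ≤ ‖Y‖)
    (Hw : GaugeField P j SU2 → (𝒳w →L[ℂ] 𝒴w)) (hHw : ∀ V X, ‖Hw V X‖ ≤ B₀w * ‖X‖)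
    (hqw : 9 * C₂w * B₀w * (ε₄w + B₀w * bw) < 1) (hRCw : 3 * (ε₄w + B₀w * bw) ≤ RCw)
    -- the displayed pinned readings and leaf-07-g6's pinned chain binders (V-uniform)
    (π𝒴 : 𝒴w →L[ℂ] P𝒴) (π𝒴' : 𝒴w' →L[ℂ] P𝒴') (π𝒳 : 𝒳w →L[ℂ] P𝒳) (πℬ : ℬw →L[ℂ] Pℬ) {qW LC cι BH B₁p bp : ℝ}
    (hGWp : ∀ V, ∀ Y Y', ‖Y‖ < ε₄w + B₀w * bw → ‖Y'‖ < ε₄w + B₀w * bw →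
      ‖π𝒴 (𝒢w V (W𝒱w V Y)) - π𝒴 (𝒢w V (W𝒱w V Y'))‖ ≤ qW * ‖π𝒴 Y - π𝒴 Y'‖) (hqW : qW < 1)
    (hCp : ∀ V, ∀ A A' : 𝒴w', ‖A‖ < RCw → ‖A'‖ < RCw → ‖π𝒳 (Cw V A) - π𝒳 (Cw V A')‖ ≤ LC * ‖π𝒴' A - π𝒴' A'‖)
    (hιp : ∀ V Y, ‖π𝒴' (ιw V Y)‖ ≤ cι * ‖π𝒴 Y‖) (hHp : ∀ V X, ‖π𝒴 (Hw V X)‖ ≤ BH * ‖π𝒳 X‖)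
    (hLC : 0 ≤ LC) (hcι : 0 ≤ cι) (hBH : 0 ≤ BH) (hk : LC * cι * BH < 1)
    (hB₁p : 0 ≤ B₁p) (hH₁p : ∀ V B, ‖π𝒴 (H₁w V B)‖ ≤ B₁p * ‖πℬ B‖)
    (hΦp : ∀ V, ∀ z ∈ ball (0 : Fin m₀ → ℂ) rΦw, ‖πℬ (Φw V z)‖ ≤ bp) (hbp : 0 ≤ bp)
    -- weight plaquettes, read-outs with PINNED letter∕curl constants (S69 (B) shape; `κ_c ∝ η²`, `κ_w ∝ η` DISPLAYED)
    {𝔭 : Type*} (Pw : Finset 𝔭) (ℓw : 𝔭 → List (𝒴w →L[ℂ] Matrix n n ℂ)) {κw κcw : 𝔭 → ℝ}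
    (hκw : ∀ p ∈ Pw, 0 ≤ κw p) (hκcw : ∀ p ∈ Pw, 0 ≤ κcw p)
    (hℓwπ : ∀ p ∈ Pw, ∀ ℓ ∈ ℓw p, ∀ Y, ‖ℓ Y‖ ≤ κw p * ‖π𝒴 Y‖)
    (hcurlπ : ∀ p ∈ Pw, ∀ Y, ‖((ℓw p).map fun ℓ => ℓ Y).sum‖ ≤ κcw p * ‖π𝒴 Y‖)
    {mw : ℕ} (hlenw : ∀ p ∈ Pw, (ℓw p).length ≤ mw)
    -- the global tuple's real structure with SKEW weight read-outs
    (𝓡𝒴w : AddSubgroup 𝒴w) (h𝓡𝒴w : IsClosed (𝓡𝒴w : Set 𝒴w)) (𝓡𝒵w : AddSubgroup 𝒵w) (𝓡𝒴w' : AddSubgroup 𝒴w')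
    (𝓡𝒳w : AddSubgroup 𝒳w) (h𝓡𝒳w : IsClosed (𝓡𝒳w : Set 𝒳w)) (𝓡ℬw : AddSubgroup ℬw)
    (h𝒢rw : ∀ V, ∀ f ∈ 𝓡𝒵w, 𝒢w V f ∈ 𝓡𝒴w) (hWrw : ∀ V, ∀ Y ∈ 𝓡𝒴w, W𝒱w V Y ∈ 𝓡𝒵w)
    (hιrw : ∀ V, ∀ Y ∈ 𝓡𝒴w, ιw V Y ∈ 𝓡𝒴w') (hHrw : ∀ V, ∀ X ∈ 𝓡𝒳w, Hw V X ∈ 𝓡𝒴w)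
    (hCrw : ∀ V, ∀ Z ∈ 𝓡𝒴w', Cw V Z ∈ 𝓡𝒳w) (hH₁rw : ∀ V, ∀ B ∈ 𝓡ℬw, H₁w V B ∈ 𝓡𝒴w)
    (hΦrw : ∀ V, ∀ y : Fin m₀ → ℝ, ‖y‖ ≤ S → Φw V (cplx y) ∈ 𝓡ℬw)
    (hskew : ∀ p ∈ Pw, ∀ ℓ ∈ ℓw p, ∀ Y ∈ 𝓡𝒴w, ℓ Y ∈ skewAdjoint (Matrix n n ℂ))
    -- the frozen background plaquettes (N-ne7cp1-g31-2), the located square budget SECOND ORDER IN THE WINDOW (S85: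
    -- `2H_p∕(r_Φ,w∕S) = 2H_p·S∕r_Φ,w`; located by `ShellMeasureLandauWilsonSquaresLocatedSchwarz.hsum_of_located_schwarz`), `0 ≤ β`
    (Bp : GaugeField P j SU2 → 𝔭 → Matrix n n ℂ) {d : 𝔭 → ℝ} (hBu : ∀ V, ∀ p ∈ Pw, Bp V p ∈ unitary (Matrix n n ℂ))
    (hBd : ∀ V, ∀ p ∈ Pw, ‖Bp V p - 1‖ ≤ d p) {Hbar : ℝ} (hHbar : 0 ≤ Hbar)
    (hsumw : ∑ p ∈ Pw, |β| * (d p + 2 * (κcw p * (B₁p * bp / ((1 - qW) * (1 - LC * cι * BH))) +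
        expTail₂ (mw * (κw p * (B₁p * bp / ((1 - qW) * (1 - LC * cι * BH)))))) / (rΦw / S)) *
      (2 * (κcw p * (B₁p * bp / ((1 - qW) * (1 - LC * cι * BH))) +
        expTail₂ (mw * (κw p * (B₁p * bp / ((1 - qW) * (1 - LC * cι * BH)))))) / (rΦw / S)) ≤ Hbar)
    -- ══ (T3) THE LOCATED NON-WILSON TERMS' SUPPLIER DATA (S71 f2 `hE_landau_chartRay_pinned`): the global tuple's PINNED
    -- INSTANCE `𝒴 := WSup (pinW δ′ ϖ) 1 𝔄`, located per-term functionals, pin depths, located sum `LK`, coupling ══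
    {Λe : Type*} [Fintype Λe] {𝔄 : Type*} [NormedAddCommGroup 𝔄] [NormedSpace ℂ 𝔄] [CompleteSpace 𝔄] {δ' : ℝ} {ϖ : Λe → ℝ}
    (hδ' : 0 ≤ δ') (hϖ : ∀ b', 0 ≤ ϖ b')
    {𝒴e' 𝒳e 𝒵e ℬe : Type*} [NormedAddCommGroup 𝒴e'] [NormedSpace ℂ 𝒴e'] [NormedAddCommGroup 𝒳e] [NormedSpace ℂ 𝒳e]
    [CompleteSpace 𝒳e] [NormedAddCommGroup 𝒵e] [NormedSpace ℂ 𝒵e] [NormedAddCommGroup ℬe] [NormedSpace ℂ ℬe]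
    (𝒢e : GaugeField P j SU2 → (𝒵e →L[ℂ] WSup (pinW δ' ϖ) 1 𝔄)) (W𝒱e : GaugeField P j SU2 → WSup (pinW δ' ϖ) 1 𝔄 → 𝒵e)
    {B₀e C₄e a₃e be ε₄e : ℝ}
    (h𝒢e : ∀ V f, ‖𝒢e V f‖ ≤ B₀e * ‖f‖) (hWe : ∀ V, Prop4Hyp (W𝒱e V) C₄e a₃e) (hB₀e : 0 < B₀e) (hC₄e : 0 ≤ C₄e)
    (hbe : 0 ≤ be) (hε₄e : 0 ≤ ε₄e) (hdome : 2 * (ε₄e + B₀e * be) ≤ a₃e)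
    (hselfe : B₀e * C₄e * (ε₄e + B₀e * be) ^ 2 ≤ ε₄e) (hcontre : 4 * B₀e * C₄e * (ε₄e + B₀e * be) < 1)
    (H₁e : GaugeField P j SU2 → (ℬe →L[ℂ] WSup (pinW δ' ϖ) 1 𝔄)) (hH₁e : ∀ V B, ‖H₁e V B‖ ≤ B₀e * ‖B‖)
    (Φe : GaugeField P j SU2 → (Fin m₀ → ℂ) → ℬe) {rΦe : ℝ} (hΦde : ∀ V, DifferentiableOn ℂ (Φe V) (ball 0 rΦe))
    (hΦ0e : ∀ V, Φe V 0 = 0) (hΦbe : ∀ V, ∀ z ∈ ball (0 : Fin m₀ → ℂ) rΦe, ‖Φe V z‖ < be) (hSre : S < rΦe)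
    (Ce : GaugeField P j SU2 → 𝒴e' → 𝒳e) {C₂e RCe : ℝ} (hC₂e : 0 ≤ C₂e)
    (hCqe : ∀ V, ∀ Z : 𝒴e', ‖Z‖ < RCe → ‖Ce V Z‖ ≤ C₂e * ‖Z‖ ^ 2) (hCde : ∀ V, DifferentiableOn ℂ (Ce V) (ball 0 RCe))
    (ιe : GaugeField P j SU2 → (WSup (pinW δ' ϖ) 1 𝔄 →L[ℂ] 𝒴e')) (hιe : ∀ V Y, ‖ιe V Y‖ ≤ ‖Y‖)
    (He : GaugeField P j SU2 → (𝒳e →L[ℂ] WSup (pinW δ' ϖ) 1 𝔄)) (hHe : ∀ V X, ‖He V X‖ ≤ B₀e * ‖X‖)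
    (hqe : 9 * C₂e * B₀e * (ε₄e + B₀e * be) < 1) (hRCe : 3 * (ε₄e + B₀e * be) ≤ RCe)
    {𝔱 : Type*} (I : Finset 𝔱) {Ef : 𝔱 → (Λe → 𝔄) → ℂ} {rE : ℝ} {ee : 𝔱 → ℝ} (hrE : 0 < rE)
    (hEd : ∀ i ∈ I, DifferentiableOn ℂ (Ef i) (ball 0 rE))
    (hEb : ∀ i ∈ I, ∀ Z ∈ ball (0 : Λe → 𝔄) rE, ‖Ef i Z‖ ≤ ee i) (he0 : ∀ i ∈ I, 0 ≤ ee i)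
    (supp : 𝔱 → Finset Λe) (hblind : ∀ i ∈ I, ∀ A₁ A₂ : Λe → 𝔄, (∀ b' ∈ supp i, A₁ b' = A₂ b') → Ef i A₁ = Ef i A₂)
    (ϖP : 𝔱 → ℝ) (hdepth : ∀ i ∈ I, ∀ b' ∈ supp i, ϖP i ≤ ϖ b')
    {LK : ℝ} (hLK : 0 ≤ LK) (hK : ∑ i ∈ I, 2 * ee i / rE * Real.exp (-(δ' * ϖP i)) ≤ LK)
    (hcoupE : ((ε₄e + B₀e * be) + B₀e * (4 * C₂e * (ε₄e + B₀e * be) ^ 2)) ≤ rE / 2)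
    {BE₁ : ℝ} (hElb₁ : ∀ V (y : Fin m₀ → ℝ), ‖y‖ ≤ S → -BE₁ ≤
      (∑ i ∈ I, Ef i (WSup.toPiL (𝔄 := 𝔄) (pinW δ' ϖ) 1
        (landauExp (Ce V) (ιe V) (He V) (4 * C₂e * (ε₄e + B₀e * be) ^ 2)
          (solAt (𝒢e V) 0 (W𝒱e V) ε₄e (0 : 𝒵e) (H₁e V (Φe V (cplx y))) + H₁e V (Φe V (cplx y)))))).re)
    -- ══ (S78) THE FLUCTUATION-DRESSED TERMS: `−log ∫ g e^{A} dμ` with an ω-UNIFORM ray constant `B_d`, integrability and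
    -- positivity of the dressed integral, a lower bound on the S-ball (all DISPLAYED) ══
    {Ω : Type*} [MeasurableSpace Ω] (μ : Measure Ω) {g : Ω → ℝ} (hg : ∀ ω, 0 ≤ g ω)
    (A : GaugeField P j SU2 → (Fin m₀ → ℝ) → Ω → ℝ) {Bd : ℝ} (hBd0 : 0 ≤ Bd)
    (hint : ∀ V, ∀ x ∈ W V, ∀ c : ℝ, 1 / 2 ≤ c → c ≤ 1 → Integrable (fun ω => g ω * Real.exp (A V (c • x) ω)) μ)
    (hpos : ∀ V, ∀ x ∈ W V, ∀ c : ℝ, 1 / 2 ≤ c → c ≤ 1 → 0 < ∫ ω, g ω * Real.exp (A V (c • x) ω) ∂μ)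
    (hA : ∀ V, ∀ x ∈ W V, ∀ c : ℝ, 1 / 2 ≤ c → c ≤ 1 → ∀ ω, A V x ω ≤ A V (c • x) ω + (1 - c) * Bd)
    {BE₂ : ℝ} (hElb₂ : ∀ V (y : Fin m₀ → ℝ), ‖y‖ ≤ S → -BE₂ ≤ (-Real.log (∫ ω, g ω * Real.exp (A V y ω) ∂μ)))
    (L : Set (𝒴 →L[ℂ] Matrix n n ℂ))
    (𝓡𝒵 : AddSubgroup 𝒵) (𝓡𝒴' : AddSubgroup 𝒴') (𝓡𝒳 : AddSubgroup 𝒳) (h𝓡𝒳 : IsClosed (𝓡𝒳 : Set 𝒳))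
    (𝓡ℬ : AddSubgroup ℬ)
    (h𝒢r : ∀ V, ∀ f ∈ 𝓡𝒵, 𝒢 V f ∈ readOutReal L) (hWr : ∀ V, ∀ Y ∈ readOutReal L, W𝒱 V Y ∈ 𝓡𝒵)
    (hιr : ∀ V, ∀ Y ∈ readOutReal L, ιs V Y ∈ 𝓡𝒴') (hHr : ∀ V, ∀ X ∈ 𝓡𝒳, Hop V X ∈ readOutReal L)
    (hCr : ∀ V, ∀ Z ∈ 𝓡𝒴', Cf V Z ∈ 𝓡𝒳) (hH₁r : ∀ V, ∀ B ∈ 𝓡ℬ, H₁ V B ∈ readOutReal L)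
    (hΦr : ∀ V, ∀ y : Fin m₀ → ℝ, ‖y‖ ≤ S → Φ V (cplx y) ∈ 𝓡ℬ)
    (hRdict : ∀ V, ∀ x ∈ cube m₀ S,
      F (fixTo T U₀ (updateFinset V Λ (expFibreChart Λ (c V) e x))) =
        Jco V x * ENNReal.ofReal (Real.exp (-((∑ p ∈ Pw, β * (1 - (Matrix.trace (Bp V p * holOf (ℓw p)
            (fun y => landauExp (Cw V) (ιw V) (Hw V) (4 * C₂w * (ε₄w + B₀w * bw) ^ 2)
              (solAt (𝒢w V) 0 (W𝒱w V) ε₄w (0 : 𝒵w) (H₁w V (Φw V (cplx y))) + H₁w V (Φw V (cplx y)))) x)).re /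
            Fintype.card n)) +
          ((∑ i ∈ I, Ef i (WSup.toPiL (𝔄 := 𝔄) (pinW δ' ϖ) 1
            (landauExp (Ce V) (ιe V) (He V) (4 * C₂e * (ε₄e + B₀e * be) ^ 2)
              (solAt (𝒢e V) 0 (W𝒱e V) ε₄e (0 : 𝒵e) (H₁e V (Φe V (cplx x))) + H₁e V (Φe V (cplx x)))))).re +
          (-Real.log (∫ ω, g ω * Real.exp (A V x ω) ∂μ)))))))
    (hudict : ∀ V, ∀ x ∈ cube m₀ S,
      u (fixTo T U₀ (updateFinset V Λ (expFibreChart Λ (c V) e x))) =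
        classifier hPu (fun p => holOf (ℓs p) (fun y => landauExp (Cf V) (ιs V) (Hop V)
          (4 * C₂ * (ε₄ + B₀ * (2 * dL * C₁ * ε₁)) ^ 2)
          (solAt (𝒢 V) 0 (W𝒱 V) ε₄ (0 : 𝒵) (H₁ V (Φ V (cplx y))) + H₁ V (Φ V (cplx y))))) x)
    (hJW : ∀ V x, Jco V x ≠ 0 → x ∈ W V)
    (hJ : ∀ V x, ∀ a : ℝ, 0 ≤ a → Jco V x ≤ Jco V (Real.exp (-a) • x))
    (hJ1 : ∀ V x, Jco V x ≤ 1)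
    (hWS : ∀ V, W V ⊆ closedBall (0 : Fin m₀ → ℝ) S)
    (hδ0 : 0 ≤ δ) (hδ1 : δ < 1) (hρ0 : 0 ≤ ρ) (hρ : ρ ≤ (1 - δ) / 2) (hβ : 0 ≤ β)
    -- SM-L2 (SM) DISCHARGED IN THE STOKES CURRENCY (S73 `hSM_of_stokes`): the η-scalings of the classifier's read-out data
    -- DISPLAYED — curl read-out × field size `κ_c·z̄ ≤ c₁η²z` (B11 (25)∕(37) TYPE), letter size `κ_r·z̄ ≤ c₂ηz` ((19) TYPE),
    -- regime `m·κ_r·z̄ ≤ 1` — the UNIT-currency smallness `36(c₁z + m²c₂²z²)∕(r_Φ∕S − 1)² ≤ δ·εθ`, and the classifier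
    -- threshold `θ := εθ·η²` (B14 (2.17) TYPE): the `η²` CANCELS
    {η εθ c₁ c₂ z : ℝ} (hη : 0 < η) (hεθ : 0 < εθ)
    (hs₁ : κc * ((ε₄ + B₀ * (2 * dL * C₁ * ε₁)) + B₀ * (4 * C₂ * (ε₄ + B₀ * (2 * dL * C₁ * ε₁)) ^ 2)) ≤ c₁ * η ^ 2 * z)
    (ha : κr * ((ε₄ + B₀ * (2 * dL * C₁ * ε₁)) + B₀ * (4 * C₂ * (ε₄ + B₀ * (2 * dL * C₁ * ε₁)) ^ 2)) ≤ c₂ * η * z)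
    (hma : m * (κr * ((ε₄ + B₀ * (2 * dL * C₁ * ε₁)) + B₀ * (4 * C₂ * (ε₄ + B₀ * (2 * dL * C₁ * ε₁)) ^ 2))) ≤ 1)
    (hsm : 36 * (c₁ * z + m ^ 2 * c₂ ^ 2 * z ^ 2) / (rΦ / S - 1) ^ 2 ≤ δ * εθ) :
    SlotAntiConcentration ((fieldMeasure P j SU2).withDensity F) u (εθ * η ^ 2) ρ
      (2 * ((m₀ : ℝ) + (3 * Hbar +
        (3 * (LK * (2 * ((ε₄e + B₀e * be) + B₀e * (4 * C₂e * (ε₄e + B₀e * be) ^ 2)))) / (rΦe / S - 1) + Bd))) / (1 - δ)) := by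
  have hSrw : S < rΦw := by linarith
  have hRade : 1 < rΦe / S := by rw [lt_div_iff₀ hS]; linarith
  have hzE : 0 ≤ ((ε₄e + B₀e * be) + B₀e * (4 * C₂e * (ε₄e + B₀e * be) ^ 2)) := by positivity
  have hBW : 0 ≤ 3 * Hbar := by positivity
  have hBE : 0 ≤ 3 * (LK * (2 * ((ε₄e + B₀e * be) + B₀e * (4 * C₂e * (ε₄e + B₀e * be) ^ 2)))) / (rΦe / S - 1) + Bd :=
    add_nonneg (div_nonneg (by positivity) (by linarith)) hBd0
  refine slotAC_realized_su2_landauChart_final hT U₀ Λ e hS hSπ c hF hFi hFsupp hu hui hPu W Jco 𝒢 W𝒱 h𝒢 hW hB₀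
    hC₄ hε₄ hdL hC₁ hε₁ hB₃ h1 h2 h3 H₁ hH₁ Φ hΦd hΦ0 hΦ hSr Cf hC₂ hCq hCd ιs hι Hop hH h18 hcoup h3R ℓs hκ hℓ hlen
    hκc hcurl
    (fun V y => ∑ p ∈ Pw, β * (1 - (Matrix.trace (Bp V p * holOf (ℓw p)
      (fun y => landauExp (Cw V) (ιw V) (Hw V) (4 * C₂w * (ε₄w + B₀w * bw) ^ 2)
        (solAt (𝒢w V) 0 (W𝒱w V) ε₄w (0 : 𝒵w) (H₁w V (Φw V (cplx y))) + H₁w V (Φw V (cplx y)))) y)).re /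
          Fintype.card n))
    (fun V y => (∑ i ∈ I, Ef i (WSup.toPiL (𝔄 := 𝔄) (pinW δ' ϖ) 1
      (landauExp (Ce V) (ιe V) (He V) (4 * C₂e * (ε₄e + B₀e * be) ^ 2)
        (solAt (𝒢e V) 0 (W𝒱e V) ε₄e (0 : 𝒵e) (H₁e V (Φe V (cplx y))) + H₁e V (Φe V (cplx y)))))).re +
      (-Real.log (∫ ω, g ω * Real.exp (A V y ω) ∂μ)))
    (BElb := BE₁ + BE₂)
    (fun V x hx c' hc hc1 => ?_) hBW (fun V x hx c' hc hc1 => ?_) hBE (fun V y hy => ?_) (fun V y hy => ?_)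
    L 𝓡𝒵 𝓡𝒴' 𝓡𝒳 h𝓡𝒳 𝓡ℬ h𝒢r hWr hιr hHr hCr hH₁r hΦr (fun V x hx => by simpa only using hRdict V x hx) hudict hJW hJ
    hJ1 hWS hδ0 hδ1 hρ0 hρ hβ hη hεθ hs₁ ha hma hsm
  · -- the WILSON slot AT TWO RADII: S74 f2 §3 through S85, per exterior section (`…_pinned_schwarz`)
    exact hE_landau_wilsonSquares_pinned_schwarz hS (hWS V) (h𝒢w V) (hWw V) hB₀w hC₄w hε₄w hdomw hselfw hcontrw (H₁w V)
      (hH₁w V) (hΦdw V) (hΦ0w V) (hΦbw V) h2Sw hC₂w (hCqw V) (hCdw V) (ιw V) (hιw V) (Hw V) (hHw V) hqw hRCw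
      π𝒴 π𝒴' π𝒳 πℬ (hGWp V) hqW (hCp V) (hιp V) (hHp V) hLC hcι hBH hk hB₁p (hH₁p V) (hΦp V) hbp ℓw hκw hκcw hℓwπ
      hcurlπ hlenw 𝓡𝒴w h𝓡𝒴w 𝓡𝒵w 𝓡𝒴w' 𝓡𝒳w h𝓡𝒳w 𝓡ℬw (h𝒢rw V) (hWrw V) (hιrw V) (hHrw V) (hCrw V) (hH₁rw V)
      (hΦrw V) hskew (Bp V) (hBu V) (hBd V) hsumw x hx c' hc hc1
  · -- the NON-WILSON slot: S71 f2 located terms ⊕ S78 dressed terms (`rayBound_add`)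
    have h1 := hE_landau_chartRay_pinned hδ' hϖ hS (hWS V) (h𝒢e V) (hWe V) hB₀e hC₄e hε₄e hdome hselfe hcontre
      (H₁e V) (hH₁e V) (hΦde V) (hΦ0e V) (hΦbe V) hSre hC₂e (hCqe V) (hCde V) (ιe V) (hιe V) (He V) (hHe V) hqe hRCe
      I hrE hEd hEb he0 supp hblind ϖP hdepth hK hcoupE x hx c' hc hc1
    have h2 := rayBound_of_logIntegral μ hg (A V) (hint V) (hpos V) (hA V) x hx c' hc hc1
    simp only at h1 h2 ⊢
    linarith
  · -- the Wilson profile is nonnegative at real chart points (S80 §1b BY NAME)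
    exact wilsonProfile_nonneg Pw (h𝒢w V) (hWw V) hB₀w hC₄w hε₄w hdomw hselfw hcontrw (H₁w V) (hH₁w V) (hΦbw V) hSrw
      hC₂w (hCqw V) (hCdw V) (ιw V) (hιw V) (Hw V) (hHw V) hqw hRCw ℓw 𝓡𝒴w h𝓡𝒴w 𝓡𝒵w 𝓡𝒴w' 𝓡𝒳w h𝓡𝒳w 𝓡ℬw
      (h𝒢rw V) (hWrw V) (hιrw V) (hHrw V) (hCrw V) (hH₁rw V) (hΦrw V) hskew (Bp V) (hBu V) hβ hy
  · -- the lower bound of the non-Wilson part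
    have h1 := hElb₁ V y hy
    have h2 := hElb₂ V y hy
    linarith

end Assembled

end Summit.QuantumFields.BalabanUV.T4Continuum.ShellMeasureLandauEndRayStokesAssembledSchwarz

end
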